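import Summits.NavierStokesRegularity.NavierStokesRegularity.Theorems.CoriolisHeadFarFieldShellMean
import Literature.Analysis.FluidPDE.NewtonPotentialHolder
import Literature.Analysis.FluidPDE.HarmonicMeanValue
import Mathlib.MeasureTheory.Group.Integral
import HarnessLib

/-!
# CoriolisHeadTypeIRatePressureKernel — crux `NoCoRotatingCore` (stmt-NavierStokesRegularity-22676), line
# `far_field_constancy` v2 (skeleton 15c9a82ad206abb9), stub K1c `stub_typeIRate` — pressure half, file 1/3:
# centred dyadic shell steps of `∂ₑP` as kernel integrals of `ΔP`

Generic potential theory on `ℝ³` (no profile system): for `P ∈ C^∞`, a centre `y`, a direction `e` and a radius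
`c > 0` let `M_c = ∫ λ^{c,2c}(z) ∂ₑP(y + z) dz` be the shell mean of `∂ₑP` CENTRED AT `y` against the tree's
mass-one weight `λ^{c,2c} = newtonFarLaplacian c (2c)`.

* §1 `shellStep_eq`, `abs_shellStep_le`: `M_c − M_{2c} = −∫ ∂ₑK_c(z) ΔP(y + z) dz` with the smooth compactly
  supported kernel `K_c = Γ∞^{c,2c} − Γ∞^{2c,4c}` (the landed telescoping identity and integration by parts of
  `CoriolisHeadFarFieldShellMean`, seat ns-s29-p2, applied to the translate `P(y + ·)`), hence
  `|M_c − M_{2c}| ≤ (2C_Γ‖e‖/c²) ∫_{|z|≤4c} |ΔP(y + z)| dz`.  Only `ΔP` — never `∂ΔP` — meets a kernel, so no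
  monopole / first-moment cancellation is needed (the obstruction met by a naive Green representation of `∂ₑP`).
* §2 the two regimes under `|ΔP(w)| ≤ K₂(1 + ‖w‖)^{−q}`: SMALL scales `8c ≤ ‖y‖`
  (`setIntegral_abs_laplacian_le_small`: the ball stays at distance `≥ ‖y‖/2` from the origin, bound
  `K₂2^q(1+‖y‖)^{−q}|B̄(0,4c)|`) and LARGE scales (`setIntegral_abs_laplacian_le_large`: translation invariance,
  `(1+|w|)^{−q} ≤ |w|^{−q}` a.e., and the radial power integral `∫_{B(0,ρ)}|w|^{−q} = 3|B₁|ρ^{3−q}/(3−q)` of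
  `NewtonPotentialHolder`, `q < 3`).
* §3 the per-scale step bounds `|M_c − M_{2c}| ≤ A₁ c (1+‖y‖)^{−q}` (small) and `≤ A₂ c^{1−q}` (large,
  `‖y‖ ≤ 8c`, `1 ≤ 8c`), with explicit `A₁, A₂`.

Files 2/3 (`…TypeIRatePressureRate.lean`: two-sided dyadic telescoping ⇒ `|∂ₑP(y) − ⟪g,e⟫| ≲ ‖y‖^{1−q}`) and 3/3
(`…TypeIRateOfGradientDecay.lean`: K1c from a power gain on `DU`) build on this.  Everything is proved; no
definitions, no named facts.  WHAT THIS IS NOT: K1c, K1a, `NoCoRotatingCore` stay OPEN; nothing here proves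
Pineau–Vicol's conjecture or NS regularity.

References: D. Gilbarg, N. S. Trudinger, *Elliptic PDE of second order* (2001), §2.4–§4.2 (flavour)
[GilbargTrudinger2001]; B. Pineau, V. Vicol, arXiv:2607.09619 (2026), Lemma 2.1 [PineauVicol2026].
-/

noncomputable section

open MeasureTheory Set Function Filter Topology Metric InnerProductSpace Real
open scoped RealInnerProductSpace Laplacian ContDiff

-- the summit and its single sub-problem share the name (CONVENTIONS §1), as in every Theorems file
set_option linter.dupNamespace false

namespace Summit.NavierStokesRegularity.NavierStokesRegularity.Theorems.CoriolisHead

namespace TypeIRate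

open Literature.Analysis.FluidPDE

/-! ## §1 The shell step of `∂ₑP` centred at `y` -/

/-- **The centred shell step is a kernel integral of `ΔP`.**  For `P ∈ C^∞(ℝ³)`, a centre `y`, a direction
`e` and a radius `c > 0`, with `M_c = ∫ λ^{c,2c}(z) ∂ₑP(y + z) dz`:
`M_c − M_{2c} = −∫ ∂ₑK_c(z) ΔP(y + z) dz`, `K_c = Γ∞^{c,2c} − Γ∞^{2c,4c}` (the landed telescoping identity and
integration by parts of `CoriolisHeadFarFieldShellMean`, applied to the translate `P(y + ·)`). [folklore] -/
theorem shellStep_eq {P : EuclideanSpace ℝ (Fin 3) → ℝ} (hP : ContDiff ℝ ∞ P)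
    (y e : EuclideanSpace ℝ (Fin 3)) {c : ℝ} (hc : 0 < c) :
    (∫ z, newtonFarLaplacian c (2 * c) z * fderiv ℝ P (y + z) e) -
        (∫ z, newtonFarLaplacian (2 * c) (4 * c) z * fderiv ℝ P (y + z) e) =
      -∫ z, fderiv ℝ (fun z : EuclideanSpace ℝ (Fin 3) => newtonFar c (2 * c) z - newtonFar (2 * c) (4 * c) z) z e
        * (Δ P) (y + z) := by
  set Py : EuclideanSpace ℝ (Fin 3) → ℝ := fun z => P (y + z) with hPy
  have hPy_smooth : ContDiff ℝ ∞ Py := hP.comp (contDiff_const.add contDiff_id)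
  have hfd : ∀ z, fderiv ℝ Py z = fderiv ℝ P (y + z) := fun z => by
    rw [hPy]; exact fderiv_comp_add_left y
  have hφ : ContDiff ℝ 2 (fun z => fderiv ℝ Py z e) :=
    (hPy_smooth.fderiv_right (m := 2) (by norm_cast)).clm_apply contDiff_const
  have h1 := shellMean_sub_shellMean_eq hc hφ
  have h2 := integral_shellKernel_mul_laplacian_fderiv hc hPy_smooth e
  have hΔ : ∀ z, (Δ Py) z = (Δ P) (y + z) := fun z => laplacian_comp_const_add P y z
  simp only [hfd] at h1 h2
  rw [h1, h2]
  simp only [hΔ]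

/-- **Kernel bound for the centred shell step**: with `C_Γ` the scale-free constant of
`exists_sq_mul_norm_fderiv_newtonFar_le`,
`|M_c − M_{2c}| ≤ (2C_Γ‖e‖/c²) ∫_{|z| ≤ 4c} |ΔP(y + z)| dz`. [folklore] -/
theorem abs_shellStep_le {C : ℝ} (hC0 : 0 ≤ C)
    (hC : ∀ w : EuclideanSpace ℝ (Fin 3), ‖w‖ ^ 2 * ‖fderiv ℝ (newtonFar 1 2) w‖ ≤ C)
    {P : EuclideanSpace ℝ (Fin 3) → ℝ} (hP : ContDiff ℝ ∞ P)
    (y e : EuclideanSpace ℝ (Fin 3)) {c : ℝ} (hc : 0 < c) :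
    |(∫ z, newtonFarLaplacian c (2 * c) z * fderiv ℝ P (y + z) e) -
        (∫ z, newtonFarLaplacian (2 * c) (4 * c) z * fderiv ℝ P (y + z) e)| ≤
      2 * C * ‖e‖ / c ^ 2 * ∫ z in closedBall (0 : EuclideanSpace ℝ (Fin 3)) (4 * c), |(Δ P) (y + z)| := by
  rw [shellStep_eq hP y e hc, abs_neg]
  set K : EuclideanSpace ℝ (Fin 3) → ℝ :=
    fun z => newtonFar c (2 * c) z - newtonFar (2 * c) (4 * c) z with hKdef
  have hΔc : Continuous fun z : EuclideanSpace ℝ (Fin 3) => (Δ P) (y + z) :=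
    (Literature.Analysis.FluidPDE.continuous_laplacian (hP.of_le (by norm_cast))).comp (continuous_const.add continuous_id)
  -- pointwise bound by an indicator
  set m : ℝ := 2 * C * ‖e‖ / c ^ 2 with hm
  have hm0 : 0 ≤ m := by positivity
  have hpt : ∀ z, ‖fderiv ℝ K z e * (Δ P) (y + z)‖ ≤
      (closedBall (0 : EuclideanSpace ℝ (Fin 3)) (4 * c)).indicator (fun z => m * |(Δ P) (y + z)|) z := by
    intro z
    by_cases hz : 4 * c < ‖z‖
    · rw [hKdef, fderiv_shellKernel_eq_zero_of_lt hc hz,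
        show (0 : EuclideanSpace ℝ (Fin 3) →L[ℝ] ℝ) e = 0 from rfl, zero_mul, norm_zero]
      exact Set.indicator_nonneg (fun _ _ => mul_nonneg hm0 (abs_nonneg _)) _
    · rw [not_lt] at hz
      rw [Set.indicator_of_mem (mem_closedBall_zero_iff.2 hz), norm_mul, Real.norm_eq_abs,
        Real.norm_eq_abs]
      refine mul_le_mul_of_nonneg_right ?_ (abs_nonneg _)
      calc |fderiv ℝ K z e| = ‖fderiv ℝ K z e‖ := (Real.norm_eq_abs _).symm
        _ ≤ ‖fderiv ℝ K z‖ * ‖e‖ := ContinuousLinearMap.le_opNorm _ _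
        _ ≤ 2 * C / c ^ 2 * ‖e‖ :=
            mul_le_mul_of_nonneg_right (norm_fderiv_shellKernel_le hC0 hC hc z) (norm_nonneg _)
        _ = m := by rw [hm]; ring
  have hint : Integrable fun z => (closedBall (0 : EuclideanSpace ℝ (Fin 3)) (4 * c)).indicator
      (fun z => m * |(Δ P) (y + z)|) z := by
    refine ((continuous_const.mul hΔc.abs).continuousOn.integrableOn_compact
      (isCompact_closedBall _ _)).integrable_indicator measurableSet_closedBall
  calc |∫ z, fderiv ℝ K z e * (Δ P) (y + z)|
      = ‖∫ z, fderiv ℝ K z e * (Δ P) (y + z)‖ := (Real.norm_eq_abs _).symm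
    _ ≤ ∫ z, (closedBall (0 : EuclideanSpace ℝ (Fin 3)) (4 * c)).indicator
          (fun z => m * |(Δ P) (y + z)|) z := norm_integral_le_of_norm_le hint (Eventually.of_forall hpt)
    _ = m * ∫ z in closedBall (0 : EuclideanSpace ℝ (Fin 3)) (4 * c), |(Δ P) (y + z)| := by
        rw [integral_indicator measurableSet_closedBall, integral_const_mul]

/-! ## §2 The two regimes of the kernel integral under `|ΔP(w)| ≤ K₂ (1 + ‖w‖)^{-q}` -/

/-- **Small scales** (`8c ≤ ‖y‖`): the ball `|z| ≤ 4c` around `y` stays at distance `≥ ‖y‖/2` from the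
origin, so `∫_{|z|≤4c} |ΔP(y+z)| ≤ K₂ 2^q (1 + ‖y‖)^{-q} · |B̄(0,4c)|`. [folklore] -/
theorem setIntegral_abs_laplacian_le_small {P : EuclideanSpace ℝ (Fin 3) → ℝ}
    {K₂ q : ℝ} (hq : 0 ≤ q)
    (hΔ : ∀ w : EuclideanSpace ℝ (Fin 3), |(Δ P) w| ≤ K₂ / (1 + ‖w‖) ^ q)
    {y : EuclideanSpace ℝ (Fin 3)} {c : ℝ} (hc : 0 < c) (hcy : 8 * c ≤ ‖y‖) :
    ∫ z in closedBall (0 : EuclideanSpace ℝ (Fin 3)) (4 * c), |(Δ P) (y + z)| ≤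
      K₂ * 2 ^ q / (1 + ‖y‖) ^ q * ((4 * c) ^ 3 * (volume (ball (0 : EuclideanSpace ℝ (Fin 3)) 1)).toReal) := by
  have hbound : ∀ z ∈ closedBall (0 : EuclideanSpace ℝ (Fin 3)) (4 * c),
      ‖|(Δ P) (y + z)|‖ ≤ K₂ * 2 ^ q / (1 + ‖y‖) ^ q := by
    intro z hz
    rw [mem_closedBall_zero_iff] at hz
    rw [Real.norm_eq_abs, abs_abs]
    refine (hΔ (y + z)).trans ?_
    have hyz : (1 + ‖y‖) / 2 ≤ 1 + ‖y + z‖ := by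
      have h := norm_sub_le_norm_add y z   -- placeholder (fixed below)
      have h' : ‖y‖ ≤ ‖y + z‖ + ‖z‖ := by
        have := norm_add_le (y + z) (-z); simp only [add_neg_cancel_right, norm_neg] at this; exact this
      linarith
    have hpos : 0 < (1 + ‖y‖) / 2 := by positivity
    have hpow : ((1 + ‖y‖) / 2) ^ q ≤ (1 + ‖y + z‖) ^ q := Real.rpow_le_rpow hpos.le hyz hq
    rw [Real.div_rpow (by positivity) zero_le_two] at hpow
    have h2q : 0 < (2 : ℝ) ^ q := Real.rpow_pos_of_pos two_pos _
    have h1q : 0 < (1 + ‖y‖) ^ q := Real.rpow_pos_of_pos (by positivity) _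
    have h3q : 0 < (1 + ‖y + z‖) ^ q := Real.rpow_pos_of_pos (by positivity) _
    have hK₂ : 0 ≤ K₂ := by
      have h := hΔ 0
      rw [norm_zero, add_zero, Real.one_rpow, div_one] at h
      exact (abs_nonneg _).trans h
    rw [div_le_div_iff₀ h3q h1q]
    rw [div_le_iff₀ h2q] at hpow
    nlinarith [mul_le_mul_of_nonneg_left hpow hK₂]
  have h := norm_setIntegral_le_of_norm_le_const
    (measure_closedBall_lt_top : volume (closedBall (0 : EuclideanSpace ℝ (Fin 3)) (4 * c)) < ⊤) hbound
  rw [Real.norm_eq_abs] at h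
  have h' := (le_abs_self _).trans h
  refine h'.trans (le_of_eq ?_)
  rw [show volume.real (closedBall (0 : EuclideanSpace ℝ (Fin 3)) (4 * c)) =
      (volume (closedBall (0 : EuclideanSpace ℝ (Fin 3)) (4 * c))).toReal from rfl,
    volumeReal_closedBall_eq (by positivity : (0 : ℝ) ≤ 4 * c)]

/-- **Large scales** (any `c > 0`): `∫_{|z|≤4c} |ΔP(y+z)| ≤ K₂ · 3|B₁| (4c + ‖y‖ + 1)^{3−q}/(3 − q)` for
`q < 3` (the ball around `y` sits inside `B(0, 4c + ‖y‖ + 1)`, and `(1 + |w|)^{-q} ≤ |w|^{-q}`).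
[folklore] -/
theorem setIntegral_abs_laplacian_le_large {P : EuclideanSpace ℝ (Fin 3) → ℝ} (hP : ContDiff ℝ 2 P)
    {K₂ q : ℝ} (hK₂ : 0 ≤ K₂) (hq : 0 ≤ q) (hq3 : q < 3)
    (hΔ : ∀ w : EuclideanSpace ℝ (Fin 3), |(Δ P) w| ≤ K₂ / (1 + ‖w‖) ^ q)
    (y : EuclideanSpace ℝ (Fin 3)) {c : ℝ} (hc : 0 < c) :
    ∫ z in closedBall (0 : EuclideanSpace ℝ (Fin 3)) (4 * c), |(Δ P) (y + z)| ≤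
      K₂ * (3 * (volume (ball (0 : EuclideanSpace ℝ (Fin 3)) 1)).toReal *
        ((4 * c + ‖y‖ + 1) ^ (3 - q) / (3 - q))) := by
  set ρ : ℝ := 4 * c + ‖y‖ + 1 with hρ
  have hρpos : 0 < ρ := by positivity
  have hΔc : Continuous fun z : EuclideanSpace ℝ (Fin 3) => |(Δ P) (y + z)| :=
    ((Literature.Analysis.FluidPDE.continuous_laplacian hP).comp (continuous_const.add continuous_id)).abs
  -- Step 1: enlarge the domain to the translate of the big ball and pass to a whole-space integral
  have hsub : closedBall (0 : EuclideanSpace ℝ (Fin 3)) (4 * c) ⊆ (fun z => y + z) ⁻¹' ball 0 ρ := by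
    intro z hz
    rw [mem_closedBall_zero_iff] at hz
    rw [mem_preimage, mem_ball_zero_iff]
    calc ‖y + z‖ ≤ ‖y‖ + ‖z‖ := norm_add_le _ _
      _ < ρ := by rw [hρ]; linarith
  -- the majorant `g(w) = K₂ ‖w‖^{-q}` on the big ball
  set g : EuclideanSpace ℝ (Fin 3) → ℝ := fun w => (ball (0 : EuclideanSpace ℝ (Fin 3)) ρ).indicator
    (fun w => K₂ * ‖w‖ ^ (-q)) w with hg
  have hgi : Integrable g := by
    rw [hg]
    have hio : IntegrableOn (fun w : EuclideanSpace ℝ (Fin 3) => K₂ * ‖w‖ ^ (-q)) (ball 0 ρ) :=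
      (NewtonPotentialHolder.integrableOn_ball_norm_rpow_neg hq3 ρ).const_mul K₂
    exact hio.integrable_indicator measurableSet_ball
  have hg0 : ∀ w, 0 ≤ g w := fun w =>
    Set.indicator_nonneg (fun w _ => mul_nonneg hK₂ (Real.rpow_nonneg (norm_nonneg _) _)) _
  -- pointwise a.e.: `1_{|z|≤4c} |ΔP(y+z)| ≤ g(y+z)` (fails only at `y + z = 0`)
  have hae : (fun z => (closedBall (0 : EuclideanSpace ℝ (Fin 3)) (4 * c)).indicator
      (fun z => |(Δ P) (y + z)|) z) ≤ᵐ[volume] fun z => g (y + z) := by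
    have hne : ∀ᵐ z : EuclideanSpace ℝ (Fin 3), z ≠ -y := by
      have : ({-y}ᶜ : Set (EuclideanSpace ℝ (Fin 3))) ∈ ae volume :=
        compl_mem_ae_iff.2 (measure_singleton _)
      filter_upwards [this] with z hz
      simpa using hz
    filter_upwards [hne] with z hz
    by_cases hzB : z ∈ closedBall (0 : EuclideanSpace ℝ (Fin 3)) (4 * c)
    · have hyz : y + z ∈ ball (0 : EuclideanSpace ℝ (Fin 3)) ρ := hsub hzB
      rw [Set.indicator_of_mem hzB]
      simp only [hg, Set.indicator_of_mem hyz]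
      have hw0 : y + z ≠ 0 := fun h => hz (by rw [← sub_eq_zero, sub_neg_eq_add, add_comm]; exact h)
      have hwpos : 0 < ‖y + z‖ := norm_pos_iff.2 hw0
      refine (hΔ (y + z)).trans ?_
      rw [div_eq_mul_inv, ← Real.rpow_neg (by positivity)]
      refine mul_le_mul_of_nonneg_left ?_ hK₂
      rw [Real.rpow_neg (by positivity), Real.rpow_neg hwpos.le]
      exact inv_anti₀ (Real.rpow_pos_of_pos hwpos _)
        (Real.rpow_le_rpow hwpos.le (by linarith) hq)
    · simp only [Set.indicator_of_notMem hzB]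
      exact hg0 _
  -- integrate
  have hint1 : Integrable fun z => (closedBall (0 : EuclideanSpace ℝ (Fin 3)) (4 * c)).indicator
      (fun z => |(Δ P) (y + z)|) z :=
    (hΔc.continuousOn.integrableOn_compact (isCompact_closedBall _ _)).integrable_indicator
      measurableSet_closedBall
  have hint2 : Integrable fun z => g (y + z) := hgi.comp_add_left y
  calc ∫ z in closedBall (0 : EuclideanSpace ℝ (Fin 3)) (4 * c), |(Δ P) (y + z)|
      = ∫ z, (closedBall (0 : EuclideanSpace ℝ (Fin 3)) (4 * c)).indicator (fun z => |(Δ P) (y + z)|) z :=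
        (integral_indicator measurableSet_closedBall).symm
    _ ≤ ∫ z, g (y + z) := integral_mono_ae hint1 hint2 hae
    _ = ∫ w, g w := integral_add_left_eq_self g y
    _ = K₂ * ∫ w in ball (0 : EuclideanSpace ℝ (Fin 3)) ρ, ‖w‖ ^ (-q) := by
        rw [hg, integral_indicator measurableSet_ball, integral_const_mul]
    _ = K₂ * (3 * (volume (ball (0 : EuclideanSpace ℝ (Fin 3)) 1)).toReal * (ρ ^ (3 - q) / (3 - q))) := by
        rw [NewtonPotentialHolder.integral_ball_norm_rpow_neg hq3 hρpos]
        rfl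

/-! ## §3 Per-scale bounds for the centred shell steps -/

/-- **Small-scale step**: for `8c ≤ ‖y‖`, `|M_c − M_{2c}| ≤ 128·C_Γ·K₂·2^q·|B₁| · ‖e‖ · c / (1 + ‖y‖)^q`. [folklore] -/
theorem abs_shellStep_le_small {C : ℝ} (hC0 : 0 ≤ C)
    (hC : ∀ w : EuclideanSpace ℝ (Fin 3), ‖w‖ ^ 2 * ‖fderiv ℝ (newtonFar 1 2) w‖ ≤ C)
    {P : EuclideanSpace ℝ (Fin 3) → ℝ} (hP : ContDiff ℝ ∞ P) {K₂ q : ℝ} (hq : 0 ≤ q)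
    (hΔ : ∀ w : EuclideanSpace ℝ (Fin 3), |(Δ P) w| ≤ K₂ / (1 + ‖w‖) ^ q)
    (y e : EuclideanSpace ℝ (Fin 3)) {c : ℝ} (hc : 0 < c) (hcy : 8 * c ≤ ‖y‖) :
    |(∫ z, newtonFarLaplacian c (2 * c) z * fderiv ℝ P (y + z) e) -
        (∫ z, newtonFarLaplacian (2 * c) (4 * c) z * fderiv ℝ P (y + z) e)| ≤
      128 * C * K₂ * 2 ^ q * (volume (ball (0 : EuclideanSpace ℝ (Fin 3)) 1)).toReal * ‖e‖ *
        (c / (1 + ‖y‖) ^ q) := by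
  have h1 := abs_shellStep_le hC0 hC hP y e hc
  have h2 := setIntegral_abs_laplacian_le_small (P := P) hq hΔ hc hcy
  have hpos : 0 ≤ 2 * C * ‖e‖ / c ^ 2 := by positivity
  refine h1.trans ((mul_le_mul_of_nonneg_left h2 hpos).trans (le_of_eq ?_))
  field_simp
  ring

/-- **Large-scale step**: for `‖y‖ ≤ 8c` and `1 ≤ 8c`, with `2 ≤ q < 3`,
`|M_c − M_{2c}| ≤ (6·C_Γ·K₂·|B₁|·20^{3−q}/(3 − q)) · ‖e‖ · c^{1−q}`. [folklore] -/
theorem abs_shellStep_le_large {C : ℝ} (hC0 : 0 ≤ C)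
    (hC : ∀ w : EuclideanSpace ℝ (Fin 3), ‖w‖ ^ 2 * ‖fderiv ℝ (newtonFar 1 2) w‖ ≤ C)
    {P : EuclideanSpace ℝ (Fin 3) → ℝ} (hP : ContDiff ℝ ∞ P) {K₂ q : ℝ} (hK₂ : 0 ≤ K₂) (hq : 0 ≤ q)
    (hq3 : q < 3) (hΔ : ∀ w : EuclideanSpace ℝ (Fin 3), |(Δ P) w| ≤ K₂ / (1 + ‖w‖) ^ q)
    (y e : EuclideanSpace ℝ (Fin 3)) {c : ℝ} (hc : 0 < c) (hyc : ‖y‖ ≤ 8 * c) (h1c : 1 ≤ 8 * c) :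
    |(∫ z, newtonFarLaplacian c (2 * c) z * fderiv ℝ P (y + z) e) -
        (∫ z, newtonFarLaplacian (2 * c) (4 * c) z * fderiv ℝ P (y + z) e)| ≤
      6 * C * K₂ * (volume (ball (0 : EuclideanSpace ℝ (Fin 3)) 1)).toReal * (20 : ℝ) ^ (3 - q) / (3 - q) *
        ‖e‖ * c ^ (1 - q) := by
  have h1 := abs_shellStep_le hC0 hC hP y e hc
  have h2 := setIntegral_abs_laplacian_le_large (hP.of_le (by norm_cast)) hK₂ hq hq3 hΔ y hc
  set V₁ : ℝ := (volume (ball (0 : EuclideanSpace ℝ (Fin 3)) 1)).toReal with hV₁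
  have hV₁0 : 0 ≤ V₁ := ENNReal.toReal_nonneg
  have h3q : 0 < 3 - q := by linarith
  -- `(4c + ‖y‖ + 1)^{3-q} ≤ (20c)^{3-q} = 20^{3-q} c^{3-q}`
  have hρ : (4 * c + ‖y‖ + 1) ^ (3 - q) ≤ (20 : ℝ) ^ (3 - q) * c ^ (3 - q) := by
    rw [← Real.mul_rpow (by norm_num) hc.le]
    exact Real.rpow_le_rpow (by positivity) (by linarith) h3q.le
  have hpos : 0 ≤ 2 * C * ‖e‖ / c ^ 2 := by positivity
  have h4 : ∫ z in closedBall (0 : EuclideanSpace ℝ (Fin 3)) (4 * c), |(Δ P) (y + z)| ≤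
      K₂ * (3 * V₁ * ((20 : ℝ) ^ (3 - q) * c ^ (3 - q) / (3 - q))) := by
    refine h2.trans ?_
    refine mul_le_mul_of_nonneg_left (mul_le_mul_of_nonneg_left ?_ (by positivity)) hK₂
    exact div_le_div_of_nonneg_right hρ h3q.le
  refine h1.trans ((mul_le_mul_of_nonneg_left h4 hpos).trans (le_of_eq ?_))
  have hc3 : c ^ (3 - q) = c ^ 2 * c ^ (1 - q) := by
    rw [show (3 : ℝ) - q = 2 + (1 - q) by ring, Real.rpow_add hc, Real.rpow_two]
  rw [hc3]
  field_simp
  ring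

end TypeIRate

end Summit.NavierStokesRegularity.NavierStokesRegularity.Theorems.CoriolisHead

end
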